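/-
Copyright (c) 2026 the pub-hodgecm-mathlib formalisation cell (harness21).  Prover seat hodgecm-mathlib-K2E3-p23 (g5), HCML Track B «K2-LIT» ∕ h413
(`stmt-HodgeConjecture-24833`), line `K2_E3_EllipticInputs`, unit U12 «Characters», road «GL-[M6]-sc» (line lead K2E3-p23 (g5), dealer K2E3-plan (g3)),
MEMO «M6sc-BLUEPRINT v4» §2 brick VOL-mixed, FILE C: THE ASSEMBLY — the Haar volume count for the MIXED torus of `GL₃(F)`.  2026-09-04.
-/
import Summits.HodgeConjecture.HodgeConjecture.Theorems.K2E3GL3MixedLeviPart                     -- ★ FILE A′ (this seat); brings ★ FILE A `K2E3GL3MixedShearCount` (+ ★ V2, B4-0 kit)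
import Summits.HodgeConjecture.HodgeConjecture.Theorems.K2E3GL3MixedLeviSectionCount             -- ★ FILE B (this seat): the `x`-section bound; brings FILE 1∕2 counts
import Summits.HodgeConjecture.HodgeConjecture.Theorems.K2E3GLnKNAIntegration                    -- ★ V1 p858137 (K2E3-p14 g5): `∫_{GL₃} f = C ∫_K ∫_N ∫_A f(kna)`
import Summits.HodgeConjecture.HodgeConjecture.Theorems.K2E3GL3TorusWindowCount                   -- ★ V3 p858172 (K2E3-p14 g5): the torus window count
import Summits.HodgeConjecture.HodgeConjecture.Theorems.K2E3GL3ModUniformizerFundamentalDomain    -- ★ B4-1m F1 p858113 (K2E3-p03 g4): `log_v_det_mul`, `isClopen_preimage_log_v_det`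
import Summits.HodgeConjecture.HodgeConjecture.Theorems.K2E3GL3SplitConjugacyVolume               -- ★ V4 p858211 (K2E3-p14 g5): `log_v_det_kna`
import Literature.NumberTheory.Automorphic.GLnParabolicIntermediateHaar                           -- ★ `exists_haar_eq_smul_map_mul` (`μ_N = κ₀ • (v,u ↦ v u)_*(αV ⊗ νU)`)
import Literature.NumberTheory.Automorphic.GLnMaximalParabolicLocalModulus                        -- ★ `isHaarMeasure_map_of_map_add`
import HarnessLib

/-!
# Road «GL-[M6]-sc», brick VOL-mixed, FILE C: THE HAAR VOLUME OF `{z : h(det z) ∈ W ∧ 𝔅_R(z) ∧ 𝔅_m(z γ z⁻¹)}` FOR THE MIXED TORUS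
# `ν {…} ≤ C(m) · |W|(2R+1)² · ‖c²/π(c)‖_F · (q⁻¹)^{B − l + ⌊l/2⌋}`, `γ = leviBlock(C_π, c)` (Harish-Chandra 1970, Part VII §3, Theorems 14 + 15 input for `T_E`)

Cell `pub/hodgecm-mathlib` (D-0151), Track B «K2-LIT», crux H413 = `stmt-HodgeConjecture-24833`, route of record `HCCMUnconditional`.  Lane
`--supports stmt-HodgeConjecture-24833 --as helper`; THEOREMS ONLY (no `def`, no `instance`, no `notation`, no named-fact hypothesis, no `sorry`); count-neutral.

THE COUNT (BLUEPRINT v4 §0.1∕§2, RULINGS (M12-5), (M13-3), (M14-0)).  `z = k · n · a` (★ V1, no modulus factor), `n = v · u ∈ N_M · U` (`N₃ = N_M ⋉ U_{(2,1)}`, ★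
`exists_haar_eq_smul_map_mul`, `αV := (x ↦ τ_x)_* μ_F` on the root group `N_M ≅ F`, ★ `exists_homeomorph_rootGroup_fin_three`): `z γ z⁻¹ = k · v (u γ_a u⁻¹) v⁻¹ · k⁻¹`,
`γ_a = a γ a⁻¹ ∈ M`.  The `k`-range is the compact `K`; the window and `𝔅_R` see only `a` (★ V4 `log_v_det_kna`, ★ V0); for fixed `(a, v)` the `u`-section has `μ_U`-mass
`≤ ‖det(1 − K_γ)‖⁻¹ μ_U(Box_m) = ‖c²/π(c)‖ μ_U(Box_m)` (★ FILE A, after `Ad(v)`, `det K_{τ_x} = 1` ★ FILE A′) and is EMPTY unless `𝔅_m(γ_β)`, `γ_β = (v a)γ(v a)⁻¹` (★ FILE A′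
`adBall_of_adBall_unipotent_mul_levi`); the `x`-section `{x : 𝔅_m((τ_x a)γ(τ_x a)⁻¹)}` has `μ_F`-mass `≤ |2|⁻¹(q⁻¹)^{B−l+⌊l/2⌋}μ_F(𝒪)` UNIFORMLY in `a` (★ FILE B); the `a`-range is
the torus window (★ V3, `≤ |W|(2R+1)² α(A(𝒪))`).  One Tonelli swap (`n ↔ a`).
* **`exists_measure_window_adBall_conj_leviBlock_le`** — THE HEAD, in the shape of ★ V4 `K2E3GL3SplitConjugacyVolume.exists_measure_window_adBall_conj_le` with the split
  Jacobian `|Δ(t)|⁻¹` replaced by the mixed weight `‖c²/(c² − Tc + N₀)‖ · (q⁻¹)^{B − l + ⌊l/2⌋}` (`(q⁻¹)^B = |c (ϖ^m)⁻¹|`, `(q⁻¹)^l ≤ |π|`; size `≍ q^m|c|³|π(c)|⁻¹·M·|disc π|^{-1/2}`).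
HONEST LABEL: HC_CM is proved only modulo the 7 printed citations (2 remaining named inputs: hLiu418 = stmt-HodgeConjecture-24832, h413 = stmt-HodgeConjecture-24833) until
rung 0 closes; count-neutral helper, closes no socket.

## References
* [HarishChandra1970] Harish-Chandra (notes by G. van Dijk), *Harmonic Analysis on Reductive p-adic Groups*, LNM 162 (1970), Part VII §1 Theorem 14 p. 60, §3 pp. 71–73.
* [Gelbart1975] S. Gelbart, *Automorphic forms on adele groups* (1975), Thm. 9.22 (iii).
* [Rogawski1990] J. D. Rogawski, *Automorphic Representations of Unitary Groups in Three Variables* (1990), §4.13 p. 70.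
-/

set_option autoImplicit false
-- the mandated namespace repeats the single-problem summit's segment (`HodgeConjecture.HodgeConjecture`)
set_option linter.dupNamespace false

noncomputable section

open MeasureTheory Measure Set Function Topology
open scoped MatrixGroups NNReal ENNReal WithZero
open Matrix ValuativeRel
open Literature.NumberTheory.Automorphic Literature.NumberTheory.GaloisRepresentations Literature.NumberTheory.GaloisRepresentations.IsNonarchimedeanLocalField
open Literature.MeasureTheory.Group
open Summit.HodgeConjecture.HodgeConjecture.Cruxes.H413.K2E3GLnAdHeightBalls Summit.HodgeConjecture.HodgeConjecture.Cruxes.H413.K2E3GLnUnipotentAdHeight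
open Summit.HodgeConjecture.HodgeConjecture.Cruxes.H413.K2E3GLnKNAIntegration Summit.HodgeConjecture.HodgeConjecture.Cruxes.H413.K2E3GL3SplitShearCount
open Summit.HodgeConjecture.HodgeConjecture.Cruxes.H413.K2E3GL3TorusWindowCount Summit.HodgeConjecture.HodgeConjecture.Cruxes.H413.K2E3GL3ModUniformizerFundamentalDomain
open Summit.HodgeConjecture.HodgeConjecture.Cruxes.H413.K2E3GL3SplitConjugacyVolume Summit.HodgeConjecture.HodgeConjecture.Cruxes.H413.K2E3GL3MixedShearCount
open Summit.HodgeConjecture.HodgeConjecture.Cruxes.H413.K2E3GL3MixedLeviPart Summit.HodgeConjecture.HodgeConjecture.Cruxes.H413.K2E3GL3MixedLeviSectionCount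

namespace Summit.HodgeConjecture.HodgeConjecture.Cruxes.H413.K2E3GL3MixedConjugacyVolume

variable {F : Type*} [Field F] [Valued F ℤᵐ⁰] [ValuativeRel F] [(Valued.v : Valuation F ℤᵐ⁰).Compatible] [IsNonarchimedeanLocalField F]

/-! ## §1 Membership and Jacobian bookkeeping for `γ = leviBlock(C_π, c)` -/

omit [Valued F ℤᵐ⁰] [ValuativeRel F] [(Valued.v : Valuation F ℤᵐ⁰).Compatible] [IsNonarchimedeanLocalField F] in
/-- `γ ∈ M_{(2,1)}` when `(γ : Matrix) = !![0, −N₀, 0; 1, T, 0; 0, 0, c]`. [folklore] -/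
theorem leviBlock_mem_standardLeviGL {γ : GL (Fin 3) F} {T N₀ c : F} (hγ : (γ : Matrix (Fin 3) (Fin 3) F) = !![0, -N₀, 0; 1, T, 0; 0, 0, c]) :
    γ ∈ standardLeviGL F (![false, false, true] : Fin 3 → Bool) := by
  rw [mem_standardLeviGL_iff, hγ]
  intro i j hij
  fin_cases i <;> fin_cases j <;> simp_all

omit [Valued F ℤᵐ⁰] [ValuativeRel F] [(Valued.v : Valuation F ℤᵐ⁰).Compatible] [IsNonarchimedeanLocalField F] in
/-- The diagonal torus `A = M_id` lies in `M_{(2,1)}`. [folklore] -/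
theorem mem_standardLeviGL_of_mem_id {a : GL (Fin 3) F} (ha : a ∈ standardLeviGL F (id : Fin 3 → Fin 3)) :
    a ∈ standardLeviGL F (![false, false, true] : Fin 3 → Bool) := by
  rw [mem_standardLeviGL_iff]
  intro i j hij
  exact (mem_standardLeviGL_id_iff a).1 ha i j (by rintro rfl; exact hij rfl)

omit [Valued F ℤᵐ⁰] [ValuativeRel F] [(Valued.v : Valuation F ℤᵐ⁰).Compatible] [IsNonarchimedeanLocalField F] in
/-- **`det(1 − K_γ) = (c² − Tc + N₀)/c²`** for the companion Levi element. [cite: Rogawski1990, §4.13, proof of Lemma 4.13.1, p. 70] -/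
theorem det_one_sub_boxAd_leviBlock {γ : GL (Fin 3) F} {T N₀ c : F} (hc : c ≠ 0) (hγ : (γ : Matrix (Fin 3) (Fin 3) F) = !![0, -N₀, 0; 1, T, 0; 0, 0, c]) :
    (1 - Matrix.of fun q q' : {i : Fin 3 // (![false, false, true] : Fin 3 → Bool) i = false} × {j : Fin 3 // (![false, false, true] : Fin 3 → Bool) j = true} =>
      (((⟨γ, standardLeviGL_le F _ (leviBlock_mem_standardLeviGL hγ)⟩ : standardParabolicGL F (![false, false, true] : Fin 3 → Bool)) : GL (Fin 3) F) : Matrix (Fin 3) (Fin 3) F) q.1 q'.1 *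
        ((((⟨γ, standardLeviGL_le F _ (leviBlock_mem_standardLeviGL hγ)⟩ : standardParabolicGL F (![false, false, true] : Fin 3 → Bool))⁻¹ :
          standardParabolicGL F (![false, false, true] : Fin 3 → Bool)) : GL (Fin 3) F) : Matrix (Fin 3) (Fin 3) F) q'.2 q.2).det =
      (c ^ 2 - T * c + N₀) / c ^ 2 := by
  have hγM := leviBlock_mem_standardLeviGL hγ
  have hw : ((γ⁻¹ : GL (Fin 3) F) : Matrix (Fin 3) (Fin 3) F) 2 2 = c⁻¹ := by
    have h := apply_two_two_mul_inv_apply_two_two hγM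
    rw [hγ] at h
    simp only [Matrix.of_apply, Matrix.cons_val', Matrix.cons_val_two, Matrix.tail_cons, Matrix.head_cons, Matrix.empty_val', Matrix.cons_val_fin_one] at h
    exact (inv_eq_of_mul_eq_one_right h).symm
  rw [det_one_sub_boxAd_of_mem_standardLeviGL γ hγM, hw, hγ]
  simp only [Matrix.of_apply, Matrix.cons_val', Matrix.cons_val_zero, Matrix.cons_val_one, Matrix.empty_val', Matrix.cons_val_fin_one]
  field_simp
  ring

/-! ## §2 The volume count -/

/-- **VOL-mixed — THE HAAR VOLUME OF `{z : h(det z) ∈ W ∧ 𝔅_R(z) ∧ 𝔅_m(z γ z⁻¹)}` FOR `γ = leviBlock(C_π, c)`** (BLUEPRINT v4 §2, RULINGS (M12-5)∕(M13-3)): for every Haar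
measure `ν` on `GL₃(F)` there is a LOCAL constant `C(m) < ∞` such that for every rootless `π = X² − TX + N₀` (`2 ≠ 0` in `F`), every `c` with `c ≠ 0`, `π(c) ≠ 0`, the element
`γ` with `(γ : Matrix) = !![0, −N₀, 0; 1, T, 0; 0, 0, c]`, every window `W`, radii `R, m`, and exponents `B, l` with `|c (ϖ^m)⁻¹| = (q⁻¹)^B`, `(q⁻¹)^l ≤ |π(x)|` for all `x`:
`ν {…} ≤ C(m) · (|W|·(2R+1)²) · (‖c²/π(c)‖_F · |2|⁻¹ · (q⁻¹)^{B − l + ⌊l/2⌋})` — the `k·n·a` count with `n = v·u`: ★ V1, ★ V3 (torus window), ★ FILE A (the `u`-shear, Jacobian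
`‖c²/π(c)‖`), ★ FILE B (the `x`-section, uniform in `a`), ★ FILE A′ (the Levi part is forced). Size: `≍ q^m |c|³ |π(c)|⁻¹ · max(1,|T|,|N₀|) · |disc π|^{-1/2}` = `|D_G(γ)|^{-1/2}` up to
local constants. [cite: HarishChandra1970, Part VII §1 Theorem 14 p. 60; §3 p. 72] [cite: Gelbart1975, Thm. 9.22 (iii)] -/
theorem exists_measure_window_adBall_conj_leviBlock_le [MeasurableSpace (GL (Fin 3) F)] [BorelSpace (GL (Fin 3) F)]
    {ϖ : F} (hϖ : Valued.v ϖ = WithZero.exp (-1 : ℤ)) (h2 : (2 : F) ≠ 0) (ν : Measure (GL (Fin 3) F)) [IsHaarMeasure ν] :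
    ∃ C : ℕ → ℝ≥0∞, (∀ m, C m ≠ ⊤) ∧ ∀ (T N₀ c : F), (∀ x : F, x ^ 2 - T * x + N₀ ≠ 0) → c ≠ 0 → c ^ 2 - T * c + N₀ ≠ 0 →
      ∀ (γ : GL (Fin 3) F), (γ : Matrix (Fin 3) (Fin 3) F) = !![0, -N₀, 0; 1, T, 0; 0, 0, c] →
      ∀ (W : Finset ℤ) (R m : ℕ) (B : ℤ) (l : ℕ), normAbs F (c * (ϖ ^ m)⁻¹) = ((residueFieldCard F : ℝ≥0)⁻¹) ^ B →
        (∀ x : F, ((residueFieldCard F : ℝ≥0)⁻¹) ^ (l : ℤ) ≤ normAbs F (x ^ 2 - T * x + N₀)) →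
        ν {z : GL (Fin 3) F | WithZero.log (Valued.v (z : Matrix (Fin 3) (Fin 3) F).det) ∈ W ∧
            (∀ i j k l', Valued.v (ϖ ^ R * ((z : Matrix (Fin 3) (Fin 3) F) i j * ((z⁻¹ : GL (Fin 3) F) : Matrix (Fin 3) (Fin 3) F) k l')) ≤ 1) ∧
            ∀ i j k l', Valued.v (ϖ ^ m * (((z * γ * z⁻¹ : GL (Fin 3) F) : Matrix (Fin 3) (Fin 3) F) i j *
              (((z * γ * z⁻¹)⁻¹ : GL (Fin 3) F) : Matrix (Fin 3) (Fin 3) F) k l')) ≤ 1} ≤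
          C m * ((W.card * (2 * R + 1) ^ 2 : ℕ) : ℝ≥0∞) *
            ((normAbs F (c ^ 2 / (c ^ 2 - T * c + N₀)) * ((normAbs F (2 : F))⁻¹ * ((residueFieldCard F : ℝ≥0)⁻¹) ^ (B - l + l / 2)) : ℝ≥0) : ℝ≥0∞) := by
  classical
  -- point-set ∕ measure-theoretic instances
  haveI : T2Space F := (isLocalField F).toT2Space
  haveI : SecondCountableTopology F := secondCountableTopology_localField F
  haveI : LocallyCompactSpace F := (isLocalField F).toLocallyCompactSpace
  haveI : IsTopologicalRing F := inferInstance
  haveI : SecondCountableTopology (Matrix (Fin 3) (Fin 3) F) := inferInstanceAs (SecondCountableTopology (Fin 3 → Fin 3 → F))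
  haveI : SecondCountableTopology (Matrix (Fin 3) (Fin 3) F)ᵐᵒᵖ := MulOpposite.opHomeomorph.symm.secondCountableTopology
  haveI : SecondCountableTopology (GL (Fin 3) F) := Units.isEmbedding_embedProduct.secondCountableTopology
  haveI : LocallyCompactSpace (Matrix (Fin 3) (Fin 3) F) := inferInstanceAs (LocallyCompactSpace (Fin 3 → Fin 3 → F))
  haveI : LocallyCompactSpace (GL (Fin 3) F) := inferInstance
  haveI : LocallyCompactSpace ↥(standardLeviGL F (id : Fin 3 → Fin 3)) := (isClosed_standardLeviGL (R := F) (id : Fin 3 → Fin 3)).locallyCompactSpace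
  haveI : LocallyCompactSpace ↥(unipotentRadicalGL F (id : Fin 3 → Fin 3)) := (isClosed_unipotentRadicalGL (R := F) (id : Fin 3 → Fin 3)).locallyCompactSpace
  haveI : LocallyCompactSpace ↥(unipotentRadicalGL F (![false, false, true] : Fin 3 → Bool)) :=
    (isClosed_unipotentRadicalGL (R := F) (![false, false, true] : Fin 3 → Bool)).locallyCompactSpace
  haveI : LocallyCompactSpace ↥(glInt 3 F) := (isCompact_glInt 3 F).isClosed.locallyCompactSpace
  haveI : BorelSpace ↥(standardLeviGL F (id : Fin 3 → Fin 3)) := Subtype.borelSpace _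
  haveI : BorelSpace ↥(glInt 3 F) := Subtype.borelSpace _
  haveI : BorelSpace ↥(unipotentRadicalGL F (id : Fin 3 → Fin 3)) := Subtype.borelSpace _
  haveI : BorelSpace ↥(unipotentRadicalGL F (![false, false, true] : Fin 3 → Bool)) := Subtype.borelSpace _
  haveI : BorelSpace ↥(unipotentRadicalGL F (id : Fin 3 → Fin 3) ⊓ standardLeviGL F (![false, false, true] : Fin 3 → Bool)) := Subtype.borelSpace _
  haveI : SecondCountableTopology ↥(standardLeviGL F (id : Fin 3 → Fin 3)) := TopologicalSpace.Subtype.secondCountableTopology _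
  haveI : SecondCountableTopology ↥(unipotentRadicalGL F (id : Fin 3 → Fin 3)) := TopologicalSpace.Subtype.secondCountableTopology _
  haveI : SecondCountableTopology ↥(unipotentRadicalGL F (![false, false, true] : Fin 3 → Bool)) := TopologicalSpace.Subtype.secondCountableTopology _
  haveI : SecondCountableTopology ↥(unipotentRadicalGL F (id : Fin 3 → Fin 3) ⊓ standardLeviGL F (![false, false, true] : Fin 3 → Bool)) :=
    TopologicalSpace.Subtype.secondCountableTopology _
  haveI : CompactSpace ↥(glInt 3 F) := isCompact_iff_compactSpace.1 (isCompact_glInt 3 F)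
  letI : MeasurableSpace F := borel F
  haveI : BorelSpace F := ⟨rfl⟩
  -- the auxiliary Haar measures: `κ` on `K`, `α` on `A`, `νU` on `U`, `αV := τ_* μF` on `N_M`, and `μN = κ₀ • (v,u ↦ v u)_* (αV ⊗ νU)` on `N₃`
  set κ : Measure ↥(glInt 3 F) := Measure.haar with hκ
  set α : Measure ↥(standardLeviGL F (id : Fin 3 → Fin 3)) := Measure.haar with hα
  set νU : Measure ↥(unipotentRadicalGL F (![false, false, true] : Fin 3 → Bool)) := Measure.haar with hνU
  set μF : Measure F := Measure.addHaar with hμF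
  obtain ⟨w, hw, hwadd⟩ := exists_homeomorph_rootGroup_fin_three F
  set αV : Measure ↥(unipotentRadicalGL F (id : Fin 3 → Fin 3) ⊓ standardLeviGL F (![false, false, true] : Fin 3 → Bool)) := Measure.map w μF with hαV
  haveI : IsHaarMeasure αV := isHaarMeasure_map_of_map_add w hwadd _
  haveI : SFinite αV := inferInstance
  haveI : SFinite νU := inferInstance
  have hmono : Monotone (![false, false, true] : Fin 3 → Bool) := by decide
  have hUN : unipotentRadicalGL F (![false, false, true] : Fin 3 → Bool) ≤ unipotentRadicalGL F (id : Fin 3 → Fin 3) :=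
    unipotentRadicalGL_comp_le (R := F) (id : Fin 3 → Fin 3) hmono
  have hNP : unipotentRadicalGL F (id : Fin 3 → Fin 3) ≤ standardParabolicGL F (![false, false, true] : Fin 3 → Bool) :=
    unipotentRadicalGL_le_standardParabolicGL_comp (R := F) (id : Fin 3 → Fin 3) hmono
  have hNc : IsClosed ((unipotentRadicalGL F (id : Fin 3 → Fin 3) : Subgroup (GL (Fin 3) F)) : Set (GL (Fin 3) F)) :=
    isClosed_unipotentRadicalGL (id : Fin 3 → Fin 3)
  set μN : Measure ↥(unipotentRadicalGL F (id : Fin 3 → Fin 3)) := Measure.haar with hμN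
  obtain ⟨e, κ₀, -, hκ₀, he, hμNe⟩ := exists_haar_eq_smul_map_mul F hNc hUN hNP μN αV νU
  haveI : IsFiniteMeasure κ := CompactSpace.isFiniteMeasure
  haveI : SFinite μN := inferInstance
  haveI : SFinite α := inferInstance
  obtain ⟨c₁, hc₁, hKNA⟩ := GLn.exists_lintegral_eq_mul_lintegral_KNA ν κ μN α
  -- the local constant
  refine ⟨fun m => (c₁ : ℝ≥0∞) * κ Set.univ * κ₀ * νU {u | ∀ i j, Valued.v (ϖ ^ m * ((u : GL (Fin 3) F) : Matrix (Fin 3) (Fin 3) F) i j) ≤ 1} *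
      μF {b : F | normAbs F b ≤ 1} * α {a | (a : GL (Fin 3) F) ∈ glInt 3 F}, fun m => ?_, ?_⟩
  · refine ENNReal.mul_ne_top (ENNReal.mul_ne_top (ENNReal.mul_ne_top (ENNReal.mul_ne_top (ENNReal.mul_ne_top ENNReal.coe_ne_top (measure_ne_top κ _)) hκ₀)
      (measure_uBox_lt_top hϖ m νU).ne) ?_) (measure_setOf_coe_mem_glInt_lt_top α).ne
    obtain ⟨a, -, ha⟩ := exists_primePowBall_eq_setOf_valuation_le (F := F) 0
    have : {b : F | normAbs F b ≤ 1} = primePowBall F 0 := by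
      ext b; rw [mem_primePowBall_iff, zpow_zero]; rfl
    rw [this]
    exact (isCompact_primePowBall 0).measure_lt_top.ne
  intro T N₀ c hπ hc hπc γ hγ W R m B l hB hl
  have hϖ0 : ϖ ≠ 0 := ne_zero_of_v_eq_exp hϖ
  have hϖ1 : Valued.v ϖ ≤ 1 := v_le_one_of_v_eq_exp hϖ
  have hγM : γ ∈ standardLeviGL F (![false, false, true] : Fin 3 → Bool) := leviBlock_mem_standardLeviGL hγ
  -- the set and its measurability
  set S : Set (GL (Fin 3) F) := {z : GL (Fin 3) F | WithZero.log (Valued.v (z : Matrix (Fin 3) (Fin 3) F).det) ∈ W ∧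
      (∀ i j k l', Valued.v (ϖ ^ R * ((z : Matrix (Fin 3) (Fin 3) F) i j * ((z⁻¹ : GL (Fin 3) F) : Matrix (Fin 3) (Fin 3) F) k l')) ≤ 1) ∧
      ∀ i j k l', Valued.v (ϖ ^ m * (((z * γ * z⁻¹ : GL (Fin 3) F) : Matrix (Fin 3) (Fin 3) F) i j *
        (((z * γ * z⁻¹)⁻¹ : GL (Fin 3) F) : Matrix (Fin 3) (Fin 3) F) k l')) ≤ 1} with hSdef
  set Bm : Set (GL (Fin 3) F) := {g | ∀ i j k l', Valued.v (ϖ ^ m * ((g : Matrix (Fin 3) (Fin 3) F) i j * ((g⁻¹ : GL (Fin 3) F) : Matrix (Fin 3) (Fin 3) F) k l')) ≤ 1} with hBm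
  have hBmo : IsOpen Bm := isOpen_setOf_adBall ϖ m
  have hconj : Continuous fun z : GL (Fin 3) F => z * γ * z⁻¹ := (continuous_id.mul continuous_const).mul continuous_id.inv
  have hS : MeasurableSet S := by
    rw [hSdef, Set.setOf_and, Set.setOf_and]
    exact (isClopen_preimage_log_v_det hϖ (W : Set ℤ)).isOpen.measurableSet.inter
      ((isOpen_setOf_adBall ϖ R).measurableSet.inter ((hBmo.preimage hconj).measurableSet))
  -- the `a`-set and the `(n, a)`-set
  set Aset : Set ↥(standardLeviGL F (id : Fin 3 → Fin 3)) := {a | WithZero.log (Valued.v ((a : GL (Fin 3) F) : Matrix (Fin 3) (Fin 3) F).det) ∈ W ∧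
      ∀ i j k l', Valued.v (ϖ ^ R * (((a : GL (Fin 3) F) : Matrix (Fin 3) (Fin 3) F) i j * (((a : GL (Fin 3) F)⁻¹ : GL (Fin 3) F) : Matrix (Fin 3) (Fin 3) F) k l')) ≤ 1}
    with hAset
  have hAm : MeasurableSet Aset := by
    rw [hAset, Set.setOf_and]
    exact ((isClopen_preimage_log_v_det hϖ (W : Set ℤ)).isOpen.measurableSet.preimage measurable_subtype_coe).inter
      ((isOpen_setOf_adBall ϖ R).measurableSet.preimage measurable_subtype_coe)
  set Tset : Set (↥(unipotentRadicalGL F (id : Fin 3 → Fin 3)) × ↥(standardLeviGL F (id : Fin 3 → Fin 3))) :=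
    {q | (q.1 : GL (Fin 3) F) * ((q.2 : GL (Fin 3) F) * γ * ((q.2 : GL (Fin 3) F))⁻¹) * ((q.1 : GL (Fin 3) F))⁻¹ ∈ Bm} with hTset
  haveI : BorelSpace (↥(unipotentRadicalGL F (id : Fin 3 → Fin 3)) × ↥(standardLeviGL F (id : Fin 3 → Fin 3))) := Prod.borelSpace
  have hTm : MeasurableSet Tset := by
    have hc : Continuous fun q : ↥(unipotentRadicalGL F (id : Fin 3 → Fin 3)) × ↥(standardLeviGL F (id : Fin 3 → Fin 3)) =>
        (q.1 : GL (Fin 3) F) * ((q.2 : GL (Fin 3) F) * γ * ((q.2 : GL (Fin 3) F))⁻¹) * ((q.1 : GL (Fin 3) F))⁻¹ :=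
      ((continuous_subtype_val.comp continuous_fst).mul (((continuous_subtype_val.comp continuous_snd).mul continuous_const).mul
        (continuous_subtype_val.comp continuous_snd).inv)).mul (continuous_subtype_val.comp continuous_fst).inv
    exact (hBmo.preimage hc).measurableSet
  -- the pointwise reading in `z = k n a`
  have hpt : ∀ (k : ↥(glInt 3 F)) (n : ↥(unipotentRadicalGL F (id : Fin 3 → Fin 3))) (a : ↥(standardLeviGL F (id : Fin 3 → Fin 3))),
      S.indicator (fun _ => (1 : ℝ≥0∞)) ((k : GL (Fin 3) F) * (n : GL (Fin 3) F) * (a : GL (Fin 3) F)) ≤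
        Tset.indicator (fun _ => (1 : ℝ≥0∞)) (n, a) * Aset.indicator (fun _ => (1 : ℝ≥0∞)) a := by
    intro k n a
    by_cases hz : (k : GL (Fin 3) F) * (n : GL (Fin 3) F) * (a : GL (Fin 3) F) ∈ S
    · obtain ⟨hzW, hzB, hzC⟩ := hz
      obtain ⟨hk1, hk2⟩ := (mem_glInt_iff_forall_v_le_one (k : GL (Fin 3) F)).1 k.2
      have hk3 : ∀ i j, Valued.v ((((k : GL (Fin 3) F)⁻¹⁻¹ : GL (Fin 3) F) : Matrix (Fin 3) (Fin 3) F) i j) ≤ 1 := by rw [inv_inv]; exact hk1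
      have hnT : (n, a) ∈ Tset := by
        rw [hTset, Set.mem_setOf_eq]
        have hgrp : (k : GL (Fin 3) F) * (n : GL (Fin 3) F) * (a : GL (Fin 3) F) * γ * ((k : GL (Fin 3) F) * (n : GL (Fin 3) F) * (a : GL (Fin 3) F))⁻¹ =
            (k : GL (Fin 3) F) * ((n : GL (Fin 3) F) * ((a : GL (Fin 3) F) * γ * ((a : GL (Fin 3) F))⁻¹) * ((n : GL (Fin 3) F))⁻¹) * ((k : GL (Fin 3) F))⁻¹ := by group
        rw [hgrp] at hzC
        exact (adBall_mul_left_iff ϖ m hk1 hk2 _).1 ((adBall_mul_right_iff ϖ m hk2 hk3 _).1 hzC)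
      have haA : a ∈ Aset := by
        refine ⟨?_, ?_⟩
        · rwa [log_v_det_kna k.2 n.2] at hzW
        · rw [mul_assoc] at hzB
          have hna := (adBall_mul_left_iff ϖ R hk1 hk2 _).1 hzB
          have hu' : ∀ j, ((((n : GL (Fin 3) F))⁻¹ : GL (Fin 3) F) : Matrix (Fin 3) (Fin 3) F) j j = 1 := fun j => by
            rw [← Subgroup.coe_inv]; exact apply_self_eq_one_of_mem (n⁻¹).2 j
          exact adBall_diagonal_of_adBall_unipotent_mul (coe_eq_diagonal a) (apply_self_eq_one_of_mem n.2) hu' hna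
      rw [Set.indicator_of_mem (show (k : GL (Fin 3) F) * (n : GL (Fin 3) F) * (a : GL (Fin 3) F) ∈ S from ⟨hzW, hzB, hzC⟩),
        Set.indicator_of_mem hnT, Set.indicator_of_mem haA, one_mul]
    · rw [Set.indicator_of_notMem hz]; exact zero_le
  -- THE INNER COUNT: for every `a`, `μN {n : (n,a) ∈ Tset} ≤ κ₀ · ‖c²/π(c)‖ νU(Box_m) · |2|⁻¹(q⁻¹)^{…} μF(𝒪)`
  set J : ℝ≥0∞ := κ₀ * ((((normAbs F (c ^ 2 / (c ^ 2 - T * c + N₀))) : ℝ≥0) : ℝ≥0∞) *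
      νU {u | ∀ i j, Valued.v (ϖ ^ m * ((u : GL (Fin 3) F) : Matrix (Fin 3) (Fin 3) F) i j) ≤ 1}) *
      ((((normAbs F (2 : F))⁻¹ * ((residueFieldCard F : ℝ≥0)⁻¹) ^ (B - l + l / 2) : ℝ≥0) : ℝ≥0∞) * μF {b : F | normAbs F b ≤ 1}) with hJ
  have hinner : ∀ a : ↥(standardLeviGL F (id : Fin 3 → Fin 3)), μN {n | (n, a) ∈ Tset} ≤ J := by
    intro a
    set γa : GL (Fin 3) F := (a : GL (Fin 3) F) * γ * ((a : GL (Fin 3) F))⁻¹ with hγa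
    have haM : (a : GL (Fin 3) F) ∈ standardLeviGL F (![false, false, true] : Fin 3 → Bool) := mem_standardLeviGL_of_mem_id a.2
    have hγaM : γa ∈ standardLeviGL F (![false, false, true] : Fin 3 → Bool) := Subgroup.mul_mem _ (Subgroup.mul_mem _ haM hγM) (Subgroup.inv_mem _ haM)
    -- `μN = κ₀ • e_*(αV ⊗ νU)` and the section of `Tset` at `a` pulled back to `N_M × U`
    have hTa : MeasurableSet {n : ↥(unipotentRadicalGL F (id : Fin 3 → Fin 3)) | (n, a) ∈ Tset} := hTm.preimage (measurable_id.prodMk measurable_const)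
    set E : Set (↥(unipotentRadicalGL F (id : Fin 3 → Fin 3) ⊓ standardLeviGL F (![false, false, true] : Fin 3 → Bool)) ×
        ↥(unipotentRadicalGL F (![false, false, true] : Fin 3 → Bool))) := e ⁻¹' {n | (n, a) ∈ Tset} with hE
    have hEm : MeasurableSet E := hTa.preimage e.continuous.measurable
    have h1 : μN {n | (n, a) ∈ Tset} = κ₀ * (αV.prod νU) E := by
      rw [hμNe, Measure.smul_apply, smul_eq_mul, ← e.toMeasurableEquiv_coe, MeasurableEquiv.map_apply]
      rfl
    rw [h1, Measure.prod_apply hEm, hJ, mul_assoc κ₀]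
    gcongr
    -- the `v`-integral of the `u`-sections
    have hsec : ∀ v : ↥(unipotentRadicalGL F (id : Fin 3 → Fin 3) ⊓ standardLeviGL F (![false, false, true] : Fin 3 → Bool)),
        νU (Prod.mk v ⁻¹' E) ≤
          {v' : ↥(unipotentRadicalGL F (id : Fin 3 → Fin 3) ⊓ standardLeviGL F (![false, false, true] : Fin 3 → Bool)) |
              ((v' : GL (Fin 3) F) * γa * ((v' : GL (Fin 3) F))⁻¹) ∈ Bm}.indicator
            (fun _ => (((normAbs F (c ^ 2 / (c ^ 2 - T * c + N₀))) : ℝ≥0) : ℝ≥0∞) *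
              νU {u | ∀ i j, Valued.v (ϖ ^ m * ((u : GL (Fin 3) F) : Matrix (Fin 3) (Fin 3) F) i j) ≤ 1}) v := by
      intro v
      have hvM : (v : GL (Fin 3) F) ∈ standardLeviGL F (![false, false, true] : Fin 3 → Bool) := v.2.2
      have hvP : (v : GL (Fin 3) F) ∈ standardParabolicGL F (![false, false, true] : Fin 3 → Bool) := standardLeviGL_le F _ hvM
      -- membership in the section, re-bracketed: `e(v,u) γa e(v,u)⁻¹ = v (u γa u⁻¹) v⁻¹`
      have hgrp : ∀ u : ↥(unipotentRadicalGL F (![false, false, true] : Fin 3 → Bool)),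
          (v : GL (Fin 3) F) * (u : GL (Fin 3) F) * ((a : GL (Fin 3) F) * γ * ((a : GL (Fin 3) F))⁻¹) * ((v : GL (Fin 3) F) * (u : GL (Fin 3) F))⁻¹ =
            ((⟨(v : GL (Fin 3) F), hvP⟩ : standardParabolicGL F (![false, false, true] : Fin 3 → Bool)) : GL (Fin 3) F) *
              ((u : GL (Fin 3) F) * γa * ((u : GL (Fin 3) F))⁻¹) *
              (((⟨(v : GL (Fin 3) F), hvP⟩ : standardParabolicGL F (![false, false, true] : Fin 3 → Bool)) : GL (Fin 3) F))⁻¹ := by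
        intro u
        change _ = (v : GL (Fin 3) F) * ((u : GL (Fin 3) F) * γa * ((u : GL (Fin 3) F))⁻¹) * ((v : GL (Fin 3) F))⁻¹
        rw [hγa]; group
      have hmemE : ∀ u : ↥(unipotentRadicalGL F (![false, false, true] : Fin 3 → Bool)), u ∈ Prod.mk v ⁻¹' E →
          ∀ i j k l', Valued.v (ϖ ^ m *
            (((((⟨(v : GL (Fin 3) F), hvP⟩ : standardParabolicGL F (![false, false, true] : Fin 3 → Bool)) : GL (Fin 3) F) *
                ((u : GL (Fin 3) F) * γa * ((u : GL (Fin 3) F))⁻¹) *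
                (((⟨(v : GL (Fin 3) F), hvP⟩ : standardParabolicGL F (![false, false, true] : Fin 3 → Bool)) : GL (Fin 3) F))⁻¹ : GL (Fin 3) F) :
                  Matrix (Fin 3) (Fin 3) F) i j *
              (((((⟨(v : GL (Fin 3) F), hvP⟩ : standardParabolicGL F (![false, false, true] : Fin 3 → Bool)) : GL (Fin 3) F) *
                ((u : GL (Fin 3) F) * γa * ((u : GL (Fin 3) F))⁻¹) *
                (((⟨(v : GL (Fin 3) F), hvP⟩ : standardParabolicGL F (![false, false, true] : Fin 3 → Bool)) : GL (Fin 3) F))⁻¹)⁻¹ : GL (Fin 3) F) :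
                  Matrix (Fin 3) (Fin 3) F) k l')) ≤ 1 := by
        intro u hu
        rw [Set.mem_preimage, hE, Set.mem_preimage, Set.mem_setOf_eq, hTset, Set.mem_setOf_eq, hBm, Set.mem_setOf_eq, he (v, u)] at hu
        simp only at hu
        rw [hgrp u] at hu
        exact hu
      by_cases hβ : v ∈ {v' : ↥(unipotentRadicalGL F (id : Fin 3 → Fin 3) ⊓ standardLeviGL F (![false, false, true] : Fin 3 → Bool)) |
          ((v' : GL (Fin 3) F) * γa * ((v' : GL (Fin 3) F))⁻¹) ∈ Bm}
      · rw [Set.indicator_of_mem hβ]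
        -- `Ad(v)` preserves `νU` (`det K_v = 1` at a root-group element), then the shear count at `γ_β = v γa v⁻¹ ∈ M`
        obtain ⟨x, rfl⟩ := w.surjective v
        have hdetKv : normAbs F (Matrix.of fun q q' : {i : Fin 3 // (![false, false, true] : Fin 3 → Bool) i = false} × {j : Fin 3 // (![false, false, true] : Fin 3 → Bool) j = true} =>
            (((⟨_, hvP⟩ : standardParabolicGL F (![false, false, true] : Fin 3 → Bool)) : GL (Fin 3) F) : Matrix (Fin 3) (Fin 3) F) q.1 q'.1 *
              ((((⟨_, hvP⟩ : standardParabolicGL F (![false, false, true] : Fin 3 → Bool))⁻¹ : standardParabolicGL F (![false, false, true] : Fin 3 → Bool)) :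
                GL (Fin 3) F) : Matrix (Fin 3) (Fin 3) F) q'.2 q.2).det = 1 := by
          rw [det_boxAd_of_mem_standardLeviGL _ hvM, hw x, coe_inv_of_coe_eq_transvection (hw x), transvection_zero_one_eq, transvection_zero_one_eq]
          simp
        have hγβM : ((⟨_, hvP⟩ : standardParabolicGL F (![false, false, true] : Fin 3 → Bool)) : GL (Fin 3) F) * γa *
            (((⟨_, hvP⟩ : standardParabolicGL F (![false, false, true] : Fin 3 → Bool)) : GL (Fin 3) F))⁻¹ ∈
            standardLeviGL F (![false, false, true] : Fin 3 → Bool) := Subgroup.mul_mem _ (Subgroup.mul_mem _ hvM hγaM) (Subgroup.inv_mem _ hvM)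
        -- the Jacobian at `γ_β` is that at `γ`
        have hPeq : (⟨_, standardLeviGL_le F _ hγβM⟩ : standardParabolicGL F (![false, false, true] : Fin 3 → Bool)) =
            (⟨_, hvP⟩ * ⟨(a : GL (Fin 3) F), standardLeviGL_le F _ haM⟩) * ⟨γ, standardLeviGL_le F _ hγM⟩ *
              (⟨_, hvP⟩ * ⟨(a : GL (Fin 3) F), standardLeviGL_le F _ haM⟩)⁻¹ := by
          apply Subtype.ext
          simp only [Subgroup.coe_mul, Subgroup.coe_inv, hγa]
          group
        have hreg' : (c ^ 2 - T * c + N₀) / c ^ 2 ≠ 0 := div_ne_zero hπc (pow_ne_zero 2 hc)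
        have hJac := det_one_sub_boxAd_leviBlock hc hγ
        have key := measure_setOf_adBall_conj_levi_le νU _ hγβM (by rw [hPeq, det_one_sub_boxAd_conj_eq, hJac]; exact hreg') hϖ1 m
        rw [hPeq, det_one_sub_boxAd_conj_eq, hJac] at key
        have key2 := measure_setOf_adBall_conj_conj_eq νU ⟨_, hvP⟩ hdetKv γa ϖ m
        refine (measure_mono fun u hu => ?_).trans (key2.le.trans (key.trans (le_of_eq ?_)))
        · exact hmemE u hu
        · rw [← map_inv₀, inv_div]
      · -- empty section: `𝔅_m(v (u γa u⁻¹) v⁻¹)` forces `𝔅_m(v γa v⁻¹)` (★ FILE A′)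
        rw [Set.indicator_of_notMem hβ]
        refine le_of_eq (measure_eq_zero_iff_ae_notMem.2 (Filter.Eventually.of_forall fun u hu => hβ ?_))
        rw [Set.mem_setOf_eq]
        have hu' := hmemE u hu
        obtain ⟨u'', hu'', heq, hM⟩ := exists_unipotent_conj_conj_eq_mul u.2 hγaM hvM
        change ∀ i j k l', Valued.v (ϖ ^ m * ((((v : GL (Fin 3) F) * ((u : GL (Fin 3) F) * γa * ((u : GL (Fin 3) F))⁻¹) * ((v : GL (Fin 3) F))⁻¹ : GL (Fin 3) F) :
            Matrix (Fin 3) (Fin 3) F) i j * ((((v : GL (Fin 3) F) * ((u : GL (Fin 3) F) * γa * ((u : GL (Fin 3) F))⁻¹) * ((v : GL (Fin 3) F))⁻¹)⁻¹ : GL (Fin 3) F) :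
            Matrix (Fin 3) (Fin 3) F) k l')) ≤ 1 at hu'
        rw [heq] at hu'
        exact adBall_of_adBall_unipotent_mul_levi hu'' hM hu'
    -- integrate the sections over `v`, then read the `v`-set through `αV = τ_* μF` and ★ FILE B
    set Vset : Set ↥(unipotentRadicalGL F (id : Fin 3 → Fin 3) ⊓ standardLeviGL F (![false, false, true] : Fin 3 → Bool)) :=
      {v' | ((v' : GL (Fin 3) F) * γa * ((v' : GL (Fin 3) F))⁻¹) ∈ Bm} with hVset
    have hVm : MeasurableSet Vset :=
      (hBmo.preimage ((continuous_subtype_val.mul continuous_const).mul continuous_subtype_val.inv)).measurableSet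
    have hVle : αV Vset ≤ ((((normAbs F (2 : F))⁻¹ * ((residueFieldCard F : ℝ≥0)⁻¹) ^ (B - l + l / 2) : ℝ≥0) : ℝ≥0∞) * μF {b : F | normAbs F b ≤ 1}) := by
      set τ : F → GL (Fin 3) F := fun x =>
        ((w x : ↥(unipotentRadicalGL F (id : Fin 3 → Fin 3) ⊓ standardLeviGL F (![false, false, true] : Fin 3 → Bool))) : GL (Fin 3) F) with hτ
      have hτw : ∀ x, τ x = ((w x : ↥(unipotentRadicalGL F (id : Fin 3 → Fin 3) ⊓ standardLeviGL F (![false, false, true] : Fin 3 → Bool))) : GL (Fin 3) F) :=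
        fun x => rfl
      rw [hαV, ← w.toMeasurableEquiv_coe, MeasurableEquiv.map_apply, w.toMeasurableEquiv_coe]
      have hB' := measure_section_adBall_conj_le μF h2 hϖ0 hπ hc hγ τ (fun x => by rw [hτw]; exact hw x) hB hl (a : GL (Fin 3) F) (coe_eq_diagonal a)
      refine (measure_mono fun x hx => ?_).trans hB'
      rw [Set.mem_preimage, hVset, Set.mem_setOf_eq, hBm, Set.mem_setOf_eq, ← hτw x] at hx
      have hgrp : τ x * γa * (τ x)⁻¹ = (τ x * (a : GL (Fin 3) F)) * γ * (τ x * (a : GL (Fin 3) F))⁻¹ := by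
        rw [hγa]; group
      rw [hgrp] at hx
      exact hx
    calc ∫⁻ v, νU (Prod.mk v ⁻¹' E) ∂αV
        ≤ ∫⁻ v, Vset.indicator (fun _ => (((normAbs F (c ^ 2 / (c ^ 2 - T * c + N₀))) : ℝ≥0) : ℝ≥0∞) *
              νU {u | ∀ i j, Valued.v (ϖ ^ m * ((u : GL (Fin 3) F) : Matrix (Fin 3) (Fin 3) F) i j) ≤ 1}) v ∂αV := lintegral_mono hsec
      _ = (((normAbs F (c ^ 2 / (c ^ 2 - T * c + N₀))) : ℝ≥0) : ℝ≥0∞) * νU {u | ∀ i j, Valued.v (ϖ ^ m * ((u : GL (Fin 3) F) : Matrix (Fin 3) (Fin 3) F) i j) ≤ 1} *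
            αV Vset := by rw [lintegral_indicator_const hVm]
      _ ≤ _ := mul_le_mul_right hVle _
  -- integrate: `a` against `n` (one Tonelli swap), then `k`
  have hA := measure_window_adBall_le α hϖ W R
  have e0 : ν S = ∫⁻ z, S.indicator (fun _ => (1 : ℝ≥0∞)) z ∂ν := (lintegral_indicator_one hS).symm
  rw [e0, hKNA _ (measurable_const.indicator hS)]
  have hf : Measurable fun q : ↥(unipotentRadicalGL F (id : Fin 3 → Fin 3)) × ↥(standardLeviGL F (id : Fin 3 → Fin 3)) =>
      Tset.indicator (fun _ => (1 : ℝ≥0∞)) q * Aset.indicator (fun _ => (1 : ℝ≥0∞)) q.2 :=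
    (measurable_const.indicator hTm).mul ((measurable_const.indicator hAm).comp measurable_snd)
  have hmid : ∀ k : ↥(glInt 3 F),
      ∫⁻ n, ∫⁻ a, S.indicator (fun _ => (1 : ℝ≥0∞)) ((k : GL (Fin 3) F) * (n : GL (Fin 3) F) * (a : GL (Fin 3) F)) ∂α ∂μN ≤ J * α Aset := by
    intro k
    calc ∫⁻ n, ∫⁻ a, S.indicator (fun _ => (1 : ℝ≥0∞)) ((k : GL (Fin 3) F) * (n : GL (Fin 3) F) * (a : GL (Fin 3) F)) ∂α ∂μN
        ≤ ∫⁻ n, ∫⁻ a, Tset.indicator (fun _ => (1 : ℝ≥0∞)) (n, a) * Aset.indicator (fun _ => (1 : ℝ≥0∞)) a ∂α ∂μN :=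
          lintegral_mono fun n => lintegral_mono fun a => hpt k n a
      _ = ∫⁻ a, ∫⁻ n, Tset.indicator (fun _ => (1 : ℝ≥0∞)) (n, a) * Aset.indicator (fun _ => (1 : ℝ≥0∞)) a ∂μN ∂α :=
          lintegral_lintegral_swap hf.aemeasurable
      _ = ∫⁻ a, Aset.indicator (fun _ => (1 : ℝ≥0∞)) a * μN {n | (n, a) ∈ Tset} ∂α := by
          refine lintegral_congr fun a => ?_
          have hTa : MeasurableSet {n : ↥(unipotentRadicalGL F (id : Fin 3 → Fin 3)) | (n, a) ∈ Tset} := hTm.preimage (measurable_id.prodMk measurable_const)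
          change ∫⁻ n, {n : ↥(unipotentRadicalGL F (id : Fin 3 → Fin 3)) | (n, a) ∈ Tset}.indicator (fun _ => (1 : ℝ≥0∞)) n * Aset.indicator (fun _ => (1 : ℝ≥0∞)) a ∂μN = _
          rw [lintegral_mul_const _ (measurable_const.indicator hTa), lintegral_indicator_const hTa, one_mul, mul_comm]
      _ ≤ ∫⁻ a, Aset.indicator (fun _ => (1 : ℝ≥0∞)) a * J ∂α := lintegral_mono fun a => mul_le_mul_right (hinner a) _
      _ = J * α Aset := by rw [lintegral_mul_const _ (measurable_const.indicator hAm), lintegral_indicator_const hAm, one_mul, mul_comm]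
  -- assemble
  beta_reduce
  calc (c₁ : ℝ≥0∞) * ∫⁻ k, ∫⁻ n, ∫⁻ a, S.indicator (fun _ => (1 : ℝ≥0∞)) ((k : GL (Fin 3) F) * (n : GL (Fin 3) F) * (a : GL (Fin 3) F)) ∂α ∂μN ∂κ
      ≤ (c₁ : ℝ≥0∞) * ∫⁻ _k : ↥(glInt 3 F), J * α Aset ∂κ := mul_le_mul_right (lintegral_mono fun k => hmid k) _
    _ = (c₁ : ℝ≥0∞) * (J * α Aset * κ Set.univ) := by rw [lintegral_const]
    _ ≤ (c₁ : ℝ≥0∞) * (J * (((W.card * (2 * R + 1) ^ 2 : ℕ) : ℝ≥0∞) * α {a | (a : GL (Fin 3) F) ∈ glInt 3 F}) * κ Set.univ) :=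
        mul_le_mul_right (mul_le_mul_left (mul_le_mul_right hA _) _) _
    _ = _ := by rw [hJ]; push_cast; ring

end Summit.HodgeConjecture.HodgeConjecture.Cruxes.H413.K2E3GL3MixedConjugacyVolume

end
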